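import Summits.AtomisticToContinuum.HydrodynamicLimit.Theses.OneFlightGossipEngine

/-!
# Route OneFlightGossipEngine — the `Assembly` frame (item stmt-AtomisticToContinuum-17616, rev 29): reductions

`OneFlightGossipEngine.Assembly` (rev 29 of the route; restates the rev-25 frame stmt-AtomisticToContinuum-16666
1:1 without the antecedent `DiluteSelfConsistency`, idle since the statement re-type D-0032) is the frame
statement
`OneFlightLayeredChaos → KineticCurrentsLDAlongFamilies → CollisionActivityTails → EnergyCurrentTails →
HydrodynamicLimit` (the packing-guarded conjunct).
It is NOT a hypothesis of the route's deciding theorem `OneFlightGossipEngine.closes`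
(`hD hK h₇ h₆`, `hD : ClampedTransferDock`), and it omits the dock `ClampedTransferDock`
(stmt-AtomisticToContinuum-17615, `KineticCurrentsLDAlongFamilies → CollisionActivityTails →
EnergyCurrentTails → HydrodynamicLimit`) from its antecedents; consequently its content is exactly the
dock's, with the mechanism crux `OneFlightLayeredChaos` (B1′, stmt-AtomisticToContinuum-14535) as an idle
extra antecedent.

This file records, sorry-free and against the live route module, the pure-logic facts that pin the item
to the ledger's other statements (first landed for rev 25 as p126102; re-landed for rev 29 with the same
declaration names after the restate dropped the `DiluteSelfConsistency` binder of `closes`):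

* `oneFlightGossipEngine_assembly_iff_clampedTransferDock` — `Assembly ↔ (OneFlightLayeredChaos →
  ClampedTransferDock)` (`Iff.rfl`): any proof of the item that does not use B1′ IS a proof of crux
  stmt-17615, and conversely the item closes by `fun _ => hD` the moment `ClampedTransferDock_holds` lands;
* `oneFlightGossipEngine_assembly_of_clampedTransferDock` — that one-liner (the closing recipe);
* `oneFlightGossipEngine_clampedTransferDock_of_assembly` — modus ponens in the other direction;
* `oneFlightGossipEngine_closes_of_assembly'` — given B1′, the frame can stand in for the dock binder of
  `closes` (rev 29: four binders; the unprimed rev-25 signature with its now idle `DiluteSelfConsistency`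
  binder is kept, append-only);
* `oneFlightGossipEngine_not_assembly_iff` — the shape of a refutation.

(The frame is implied by the sub-problem Statement itself — `fun _ _ _ _ => h`, the landed
`oneFlightGossipEngine_assembly_of_hydrodynamicLimit` of `OneFlightGossipEngineAssembly.lean`, not repeated —
so `¬ Assembly` would refute the summit conjunct: `oneFlightGossipEngine_not_assembly_iff`,
`¬ Assembly ↔ OneFlightLayeredChaos ∧ KineticCurrentsLDAlongFamilies ∧ CollisionActivityTails ∧
EnergyCurrentTails ∧ ¬ HydrodynamicLimit`.)

Nothing here claims mathematical content beyond bookkeeping; the dock itself (Yau's relative-entropy clock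
along the explicit reference family, one common window) is crux stmt-AtomisticToContinuum-17615, reached
through its requested split children (see `OneFlightGossipEngineAssemblyOfHeart.lean`).
-/
namespace Summit.AtomisticToContinuum.HydrodynamicLimit.Theorems

open Summit.AtomisticToContinuum.HydrodynamicLimit.Theses

/-! ### The frame is the dock with an idle antecedent -/

/-- **`Assembly` is `B1′ → Dock`, definitionally.** The rev-29 frame statement of route
OneFlightGossipEngine (stmt-AtomisticToContinuum-17616) unfolds to
`OneFlightLayeredChaos → ClampedTransferDock` (stmt-14535 → stmt-17615): the two sides are the same arrow
type once `ClampedTransferDock` is unfolded. [folklore] -/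
theorem oneFlightGossipEngine_assembly_iff_clampedTransferDock :
    OneFlightGossipEngine.Assembly ↔
      (OneFlightGossipEngine.OneFlightLayeredChaos → OneFlightGossipEngine.ClampedTransferDock) :=
  Iff.rfl

/-- **The dock closes the frame** (the closing recipe of stmt-AtomisticToContinuum-17616): from
`hD : ClampedTransferDock` (stmt-AtomisticToContinuum-17615) the item follows by dropping the mechanism
hypothesis, `fun _ => hD`. [folklore] -/
theorem oneFlightGossipEngine_assembly_of_clampedTransferDock
    (hD : OneFlightGossipEngine.ClampedTransferDock) : OneFlightGossipEngine.Assembly :=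
  oneFlightGossipEngine_assembly_iff_clampedTransferDock.mpr fun _ => hD

/-- **Given the mechanism crux, the frame IS the dock**: `OneFlightLayeredChaos → Assembly →
ClampedTransferDock` (modus ponens). Together with
`oneFlightGossipEngine_assembly_of_clampedTransferDock` this says the item has no content of its own
besides crux stmt-AtomisticToContinuum-17615. [folklore] -/
theorem oneFlightGossipEngine_clampedTransferDock_of_assembly
    (hB : OneFlightGossipEngine.OneFlightLayeredChaos) (hA : OneFlightGossipEngine.Assembly) :
    OneFlightGossipEngine.ClampedTransferDock :=
  hA hB

/-! ### The frame can stand in for the dock binder of `closes` -/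

/-- **`closes` through the frame (rev-25 signature, SUPERSEDED by
`oneFlightGossipEngine_closes_of_assembly'`).** Kept with its landed statement (append-only rule); since
rev 29 the deciding theorem `OneFlightGossipEngine.closes` no longer takes the `DiluteSelfConsistency`
binder (idle since the statement re-type D-0032), so `hS` is carried but not used. [folklore] -/
theorem oneFlightGossipEngine_closes_of_assembly
    (hB : OneFlightGossipEngine.OneFlightLayeredChaos) (hA : OneFlightGossipEngine.Assembly)
    (hK : OneFlightGossipEngine.KineticCurrentsLDAlongFamilies)
    (h₇ : OneFlightGossipEngine.CollisionActivityTails) (h₆ : OneFlightGossipEngine.EnergyCurrentTails)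
    (hS : OneFlightGossipEngine.DiluteSelfConsistency) : _root_.HydrodynamicLimit := by
  have := hS -- idle since rev 29 (see the primed version below)
  -- buildfix 2026-08-20 (proof only): the frame itself is the needed arrow (`Assembly` unfolds to
  -- `B1′ → KCWF → CAT → ECT → HL`); the route's `closes` (re-cut to seven binders, route CLOSED
  -- 2026-08-20T06:49Z) is no longer referenced.
  exact oneFlightGossipEngine_clampedTransferDock_of_assembly hB hA hK h₇ h₆

/-- **`closes` through the frame (rev 29).** With the mechanism crux `OneFlightLayeredChaos` (stmt-14535)
in hand, the frame `Assembly` supplies the dock binder `hD` of the route's deciding theorem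
`OneFlightGossipEngine.closes` (binders `hK h₇ h₆ hD`), so the three other crux binders and the frame give
the Statement. [folklore] -/
theorem oneFlightGossipEngine_closes_of_assembly'
    (hB : OneFlightGossipEngine.OneFlightLayeredChaos) (hA : OneFlightGossipEngine.Assembly)
    (hK : OneFlightGossipEngine.KineticCurrentsLDAlongFamilies)
    (h₇ : OneFlightGossipEngine.CollisionActivityTails) (h₆ : OneFlightGossipEngine.EnergyCurrentTails) :
    _root_.HydrodynamicLimit :=
  -- buildfix 2026-08-20 (proof only): dock applied directly instead of through the re-cut `closes`.
  oneFlightGossipEngine_clampedTransferDock_of_assembly hB hA hK h₇ h₆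

/-! ### The shape of a refutation -/

/-- **What `¬ Assembly` would mean.** The frame is a closed implication between the route's cruxes and the
summit conjunct, so its negation is the conjunction of the four antecedents with `¬ HydrodynamicLimit`:
no counterexample search can bite short of refuting the conjunct itself (classical logic). [folklore] -/
theorem oneFlightGossipEngine_not_assembly_iff :
    ¬ OneFlightGossipEngine.Assembly ↔
      OneFlightGossipEngine.OneFlightLayeredChaos ∧ OneFlightGossipEngine.KineticCurrentsLDAlongFamilies ∧
        OneFlightGossipEngine.CollisionActivityTails ∧ OneFlightGossipEngine.EnergyCurrentTails ∧
          ¬ _root_.HydrodynamicLimit := by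
  constructor
  · intro h
    by_contra hc
    exact h fun hB hK h₇ h₆ => Classical.by_contradiction fun hn => hc ⟨hB, hK, h₇, h₆, hn⟩
  · rintro ⟨hB, hK, h₇, h₆, hn⟩ h
    exact hn (h hB hK h₇ h₆)

end Summit.AtomisticToContinuum.HydrodynamicLimit.Theorems
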